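import Literature.AlgebraicGeometry.Resolution.ThreefoldResolutionDatum
import HarnessLib

/-!
# Cutkosky 2009, proof of Thm. 7.2: the single asserted steps — triple points, double curves, two-dimensional components (named facts, † asserted without argument)

Topic: `Literature/AlgebraicGeometry/Resolution`. Three NAMED FACTS, statements only, transcribing
the three SINGLE-STEP sentences of the proof of Theorem 7.2 of S. D. Cutkosky, *Resolution of
singularities for 3-folds in positive characteristic*, Amer. J. Math. **131** (2009) 59–127
[Cutkosky2009] (held author version `paper:doi-10-1353-ajm-0-0036`; "pNN Lmm" = page, line of its
text layer) which print ASSERTS WITHOUT ARGUMENT (marked † in each docstring; they are elementary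
blow-up geometry of a simple-normal-crossings divisor on a nonsingular 3-fold, resp. of a
two-dimensional component of the top locus of an ideal of maximal order `r`), over the vocabulary of
`ThreefoldResolutionDatum.lean` (`ResDatum`, `eta`, `singR`, `IsPermissible`, `IsTransform`, `Reach`,
`IsComponentOfSingR`). Standing hypotheses of §7 (p20 L85–88): `V` a nonsingular 3-fold over an
algebraically closed field `k`, `R` a resolution datum with `r = ν(R) ≥ 1` — the fields of `ResDatum`
plus `[IsAlgClosed k]`.

* `Cutkosky2009_thm_7_2_triplePoints_blowup` (p21 L22–23): blowing up all triple points of `E` in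
  `Sing_r` (at once) is permissible and gives `η ≤ 2` on `Sing_r`.
* `Cutkosky2009_thm_7_2_doubleCurves_blowup` (p21 L24–26): then blowing up all double curves of `E`
  inside `Sing_r` (at once) is permissible and gives `η ≤ 2` on `Sing_r` with `η = 2` at finitely many
  points of `Sing_r`.
* `Cutkosky2009_thm_7_2_surfaceComponent_blowup` (p22 L54 – p23 L2): once conclusion 1 holds, a
  two-dimensional component `S` of `Sing_r` is nonsingular, isolated in `Sing_r`, a permissible centre
  (transversality "by Lemma 7.1", applied along the sequence from `R = (∅, E, I, V)` — stated in that
  history form), and blowing it up leaves no point of `Sing_r` over `S`.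

Vocabulary (definitions): `ResDatum.triplePointsInSingR`, `ResDatum.doubleCurvesInSingR` (union of
the components of pairwise intersections of distinct `E⁻`-members lying in `Sing_r`),
`ResDatum.etaTwoPointsInSingR`, `ResDatum.idealOfClosure` (reduced structure on the closure of a
subset: the "all at once" centres). PROVED: `…triplePoints_blowup.eta_le_two_of_empty`,
`…surfaceComponent_blowup.isPermissible_self`.

## Faithfulness notes

* Print blows up "all triple points" / "all double curves in `Sing_r`" AT ONCE; the facts keep that
  (one centre = the reduced union); the context each sentence names is a hypothesis (`E⁺ = ∅` for the
  first step, `η ≤ 2` on `Sing_r` for the second, "reached from `(∅, E, I, V)`" and conclusion 1 for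
  the two-dimensional components). The companion files `ThreefoldResolutionStableFormPhases.lean`
  (forced chains) and `ThreefoldResolutionAlgorithms.lean` (§8) hold the phases print PROVES.
* † These three sentences carry no proof in print; they are typed as print's assertions (a refereed
  published paper), not adjudicated here. AI transcription; AI review is weaker than expert review.
-/

noncomputable section

namespace Literature.AlgebraicGeometry.Resolution

universe u

open CategoryTheory AlgebraicGeometry TopologicalSpace IsLocalRing

/-! ## Vocabulary: triple points and double curves of `E⁻` inside `Sing_r` -/

namespace Cutkosky2009.ResDatum

variable {k : Type u} [Field k]

/-- **"Triple points of `E` (points `p` with `η(p) = 3`) in `Sing_r(R)`"** (p21 L22–23), as a subset of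
`V`. [cite: Cutkosky2009, proof of Thm. 7.2 (p. 21 l. 22–23)] -/
def triplePointsInSingR (R : ResDatum k) : Set R.V :=
  {x | x ∈ R.singR ∧ R.eta x = 3}

/-- **"Double curves of `E` (curves `C` such that `η(p) = 2` for all `p ∈ C`) in `Sing_r(R_1)`"**
(p21 L24–25): the union of those irreducible components of the pairwise intersections of distinct
members of `E⁻` which are contained in `Sing_r(R)`. [cite: Cutkosky2009, proof of Thm. 7.2 (p. 21 l. 24–25)] -/
def doubleCurvesInSingR (R : ResDatum k) : Set R.V :=
  ⋃₀ {Z : Set R.V | ∃ D ∈ R.Eminus, ∃ D' ∈ R.Eminus, D ≠ D' ∧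
    IsIrreducible Z ∧ Z ⊆ (D.support : Set R.V) ∩ (D'.support : Set R.V) ∧
      (∀ Z' : Set R.V, IsIrreducible Z' → Z ⊆ Z' → Z' ⊆ (D.support : Set R.V) ∩ (D'.support : Set R.V) →
        Z' ⊆ Z) ∧ Z ⊆ R.singR}

/-- The points of `Sing_r(R)` with `η = 2` ("`η(p) = 2` at only finitely many points", p21 L25–26).
[cite: Cutkosky2009, proof of Thm. 7.2 (p. 21 l. 25–26)] -/
def etaTwoPointsInSingR (R : ResDatum k) : Set R.V :=
  {x | x ∈ R.singR ∧ R.eta x = 2}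

/-- The reduced closed subscheme structure on the closure of a subset `T ⊆ V` (the centre "all triple
points … at once" / "all double curves … at once" of p21 L22–25; for a finite set of closed points or
a closed union of curves the closure is `T` itself). [cite: Cutkosky2009, proof of Thm. 7.2 (p. 21 l. 22–25)] -/
def idealOfClosure (R : ResDatum k) (T : Set R.V) : R.V.IdealSheafData :=
  AlgebraicGeometry.Scheme.IdealSheafData.vanishingIdeal ⟨closure T, isClosed_closure⟩

end Cutkosky2009.ResDatum

/-! ## Thm. 7.2, proof, the single asserted steps (each † : asserted by print without argument) -/

/-- NAMED FACT — **Cutkosky 2009, proof of Thm. 7.2, the triple points** (p21 L22–23; † no argument in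
print): "We begin by blowing up all triple points of `E` (points `p` with `η(p) = 3`) in `Sing_r(R)`
to construct `V_1 → V` such that `η(p) ≤ 2` for `p ∈ Sing_r(R_1)`." (`R = (∅, E, I, V)`, p21 L14; `V`
a nonsingular 3-fold over an algebraically closed field, p20 L85–88.) Rendered: for a datum with
`E⁺ = ∅`, (i) if there are triple points of `E` in `Sing_r(R)`, their (reduced) union is a permissible
centre and after the transform along a blow-up of it `η ≤ 2` on `Sing_r`; (ii) if there are none,
`η ≤ 2` on `Sing_r(R)` already. Users take `(h : Cutkosky2009_thm_7_2_triplePoints_blowup)`.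
[cite: Cutkosky2009, proof of Thm. 7.2 (author version p. 21 l. 22–23)] -/
def Cutkosky2009_thm_7_2_triplePoints_blowup : Prop :=
  ∀ (k : Type u) [Field k] [IsAlgClosed k] (R : Cutkosky2009.ResDatum k), R.Eplus = [] →
    (R.triplePointsInSingR.Nonempty →
      R.IsPermissible (R.idealOfClosure R.triplePointsInSingR) ∧
        ∀ (R' : Cutkosky2009.ResDatum k) (τ : R'.V ⟶ R.V),
          R.IsTransform R' (R.idealOfClosure R.triplePointsInSingR) τ →
            ∀ x' ∈ R'.singR, R'.eta x' ≤ 2) ∧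
    (R.triplePointsInSingR = ∅ → ∀ x ∈ R.singR, R.eta x ≤ 2)

/-- NAMED FACT — **Cutkosky 2009, proof of Thm. 7.2, the double curves** (p21 L24–26; † no argument
in print): "We then blow up all double curves of `E` (curves `C` such that `η(p) = 2` for all `p ∈ C`)
in `Sing_r(R_1)` to construct `V_2 → V_1` such that `η(p) ≤ 2` for `p ∈ Sing_r(R_2)`, and `η(p) = 2`
at only finitely many points." (Context at `V_1`: `η ≤ 2` on `Sing_r(R_1)`, p21 L23.) Rendered: for a
datum with `η ≤ 2` on `Sing_r`, (i) if some double curve of `E⁻` lies in `Sing_r(R)`, the (reduced)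
union of all of them is a permissible centre and after the transform along a blow-up of it `η ≤ 2` on
`Sing_r` with `η = 2` at only finitely many points of `Sing_r`; (ii) if there is none, `η = 2` holds at
only finitely many points of `Sing_r(R)` already.
Users take `(h : Cutkosky2009_thm_7_2_doubleCurves_blowup)`.
[cite: Cutkosky2009, proof of Thm. 7.2 (author version p. 21 l. 24–26)] -/
def Cutkosky2009_thm_7_2_doubleCurves_blowup : Prop :=
  ∀ (k : Type u) [Field k] [IsAlgClosed k] (R : Cutkosky2009.ResDatum k),
    (∀ x ∈ R.singR, R.eta x ≤ 2) →
    (R.doubleCurvesInSingR.Nonempty →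
      R.IsPermissible (R.idealOfClosure R.doubleCurvesInSingR) ∧
        ∀ (R' : Cutkosky2009.ResDatum k) (τ : R'.V ⟶ R.V),
          R.IsTransform R' (R.idealOfClosure R.doubleCurvesInSingR) τ →
            (∀ x' ∈ R'.singR, R'.eta x' ≤ 2) ∧ R'.etaTwoPointsInSingR.Finite) ∧
    (R.doubleCurvesInSingR = ∅ → R.etaTwoPointsInSingR.Finite)

/-- NAMED FACT — **Cutkosky 2009, proof of Thm. 7.2, the two-dimensional components of `Sing_r`**
(p22 L54 – p23 L2; † the assertions "nonsingular and isolated" and "`Sing_r(R'_1) ∩ π⁻¹(S) = ∅`" carry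
no argument in print, the transversality is "by Lemma 7.1"): "Suppose that `S` is a 2 dimensional
irreducible component of `Sing_r(R_6)`. Then `S` is nonsingular and isolated in `Sing_r(R_6)`. For
`p ∈ S`, `S` is an approximate hypersurface `D_p` for `I_6` at `p`. `E_6⁺` is transversal to `D_p`, by
Lemma 7.1. Thus `S` is transversal to `E_6 = E_6⁺ + E_6⁻` at all `p ∈ S`. The blow up `W_1 → V_6` of
`S` is thus permissible. We have `Sing_r(R'_1) ∩ π_2⁻¹(S) = ∅` … Repeating this construction for all
2 dimensional components of `Sing_r(R_6)`, we construct `V_7 → V_6` such that `dim Sing_r(R_7) ≤ 1`."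
(Context at `V_6`: `R_6` is reached from `R = (∅, E, I, V)` by permissible transforms — which is what
Lemma 7.1 is applied along — and conclusion 1, `Sing_r(R_6) ∩ E_6⁻ = ∅`, holds, p22 L52–53.)
Rendered: for `R` reached from a datum with `E⁺ = ∅` and satisfying conclusion 1, and `S` a
two-dimensional irreducible component of `Sing_r(R)`: the reduced subscheme on `S` is regular; `S` is
isolated in `Sing_r(R)` (no point of `S` is in the closure of `Sing_r(R) ∖ S`); it is a permissible
centre; and after the transform along a blow-up of it no point of `Sing_r` lies over `S`.
Users take `(h : Cutkosky2009_thm_7_2_surfaceComponent_blowup)`.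
[cite: Cutkosky2009, proof of Thm. 7.2 (author version p. 22 l. 54 – p. 23 l. 2)] -/
def Cutkosky2009_thm_7_2_surfaceComponent_blowup : Prop :=
  ∀ (k : Type u) [Field k] [IsAlgClosed k] (R₀ R : Cutkosky2009.ResDatum k) (S : Closeds R.V),
    R₀.Eplus = [] → R₀.Reach R →
    (∀ x ∈ R.singR, ∀ D ∈ R.Eminus, x ∉ (D.support : Set R.V)) →
    R.IsComponentOfSingR S → topologicalKrullDim S = 2 →
    Scheme.IsRegular (AlgebraicGeometry.Scheme.IdealSheafData.vanishingIdeal S).subscheme ∧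
      (∀ x ∈ (S : Set R.V), x ∉ closure (R.singR \ (S : Set R.V))) ∧
      R.IsPermissible (AlgebraicGeometry.Scheme.IdealSheafData.vanishingIdeal S) ∧
      ∀ (R' : Cutkosky2009.ResDatum k) (τ : R'.V ⟶ R.V),
        R.IsTransform R' (AlgebraicGeometry.Scheme.IdealSheafData.vanishingIdeal S) τ →
          ∀ x' : R'.V, τ.base x' ∈ (S : Set R.V) → x' ∉ R'.singR

/-! ## Proved consequences -/

namespace Cutkosky2009_thm_7_2_triplePoints_blowup

variable {k : Type u} [Field k] [IsAlgClosed k]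

/-- Either way, after the triple-point step `η ≤ 2` on `Sing_r`: if there is no triple point in
`Sing_r(R)` the datum itself qualifies. [cite: Cutkosky2009, proof of Thm. 7.2 (p. 21 l. 22–23)] -/
theorem eta_le_two_of_empty (h : Cutkosky2009_thm_7_2_triplePoints_blowup.{u})
    (R : Cutkosky2009.ResDatum k) (hE : R.Eplus = []) (h0 : R.triplePointsInSingR = ∅) :
    ∀ x ∈ R.singR, R.eta x ≤ 2 :=
  (h k R hE).2 h0

end Cutkosky2009_thm_7_2_triplePoints_blowup

namespace Cutkosky2009_thm_7_2_surfaceComponent_blowup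

variable {k : Type u} [Field k] [IsAlgClosed k]

/-- In particular (the case `R₀ = R`): for a datum with `E⁺ = ∅` satisfying conclusion 1, every
two-dimensional component of `Sing_r` is a permissible centre. [cite: Cutkosky2009, proof of Thm. 7.2 (p. 22 l. 54–58)] -/
theorem isPermissible_self (h : Cutkosky2009_thm_7_2_surfaceComponent_blowup.{u})
    (R : Cutkosky2009.ResDatum k) (hE : R.Eplus = [])
    (h1 : ∀ x ∈ R.singR, ∀ D ∈ R.Eminus, x ∉ (D.support : Set R.V)) (S : Closeds R.V)
    (hS : R.IsComponentOfSingR S) (hd : topologicalKrullDim S = 2) :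
    R.IsPermissible (AlgebraicGeometry.Scheme.IdealSheafData.vanishingIdeal S) :=
  (h k R R S hE (Cutkosky2009.ResDatum.Reach.refl R) h1 hS hd).2.2.1

end Cutkosky2009_thm_7_2_surfaceComponent_blowup

end Literature.AlgebraicGeometry.Resolution

end
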